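import Summits.QuantumFields.BalabanUV.Beta.GAN24.ChainTableLegCoClosed

/-!
# `BalabanUV.Beta.GAN24.ChainTableLegTelescopeCell` — binder row G-an2-4 ∕ (CONV-C), W-slot CT-W, route «WC-TL» ∕ «QR-LL», row (LT) ∕ K-LL-4, the (Q-R)^{cc} re-cut
# (RULING R-gan24p1-g29-2 (4), journal l.45244): **THE TABLE ONE-GAUGE CELL OF THE TELESCOPE SOCKET VANISHES ON CO-CLOSED LETTERS** — `push₃ l r (legChain T m k − respStep
# (Lc^m) (Lc^(m+k+1))) S = 0` for ANY kernel legs (so `LayerTransportCells.biLoc_smul_push₃_of_telescope`'s `h₃` holds with `K₃ = 0`), and the flux-free analogue relative to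
# the one-shot dressed composite column

NOT IN PRINT; OUR BOOKKEEPING ([folklore] corollaries of my `ChainTableLegCoClosed` (p335631 ✓): the difference leg IS the pure gauge `dz λ`
(`ContactKernelCells.legChain_respStepBmSeq_sub_respStep`), its table vertex is `Σ'_u λ(u)·divV S u` (`GaugeTableSlotByParts.vertexW_dz_eq_tsum_mul_divV`) = `0` on a
co-closed letter, resp. `Σ'_u Ψ(u)·divV S u = 0` on a flux-free letter (`Ψ` block-constant, `tsum_blockConst_mul_divV_eq_zero_of_fluxFree`); so
`push₃ = ffRead (Lk l ∘ 0 ∘ Rk r) = 0`; G-an2-4 formalisation swarm → CRUX TEAM (2), leaf prover `b2b-balaban-gan24-formalise-leaf-01`, gen 67 — split off the parent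
file by the 400-line rule).  HONEST FRAMING (cell contract, verbatim): «discharging `BetaPertH` makes Bałaban's UV stability UNCONDITIONAL — a real constructive-QFT
result; it is NOT the continuum limit and NOT the Clay problem.»  HONEST DEPENDENCY (verbatim): «continuum YM on T⁴ ⇐ BetaPertH ∧ nine spine estimates (0/9 proved);
BetaPertH ⇐ (D1) ∧ (D4) ∧ CAP+tail; G-an2-4 gates asym, D1 and NE2/3/4.»

## Why
The END `WardRemainderEndThreeSplit` displays ONE layer bound `hLT` per sub-letter for `push₃ T T T X`, `T = legChain (respStepBmSeq ρ Lc) (m+1) k`; my g65 telescope socket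
`LayerTransportCells.biLoc_smul_push₃_of_telescope` supplies it from the pure cell `push₃ U U U X` ((UUU): `LayerTransportUndressedThree`, tree, `k`-uniform) plus THREE
one-gauge cells `push₃ (T−U) T T X`, `push₃ U (T−U) T X`, `push₃ U U (T−U) X`.  For the (Q-R)^{cc} part of the re-cut — CO-CLOSED sub-letters — THIS file makes the third
(TABLE) cell IDENTICALLY ZERO at the composite level, for every `k`, with NO hypothesis on the co-legs: `hLT^{cc} ⟸ (UUU) + the two KERNEL one-gauge cells` ((ii-G)'s
objects), in the EXISTING composite END — no level-by-level END, whose per-level constant (the (UUU) cell's `K`, products of `(d+1)³·A²A′·Zl(…)²·…`) would compound as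
`Π_j (K·Lc^{−1/2})`.  On FLUX-free (interior-born) letters the analogous cell relative to the ONE-shot dressed column `respStepBm ρ Lc (Lc^m) (Lc^(m+k+1))` vanishes, leaving
exactly one table dressing (`ChainTableLegCoClosed` §3) — «the base count once».
§1 `ffRead_zero`; **`push₃_chainGauge_eq_zero_of_divFree`**, **`biLoc_smul_push₃_chainGauge_of_divFree`** (the socket's `h₃` with `K₃ = 0`),
**`push₃_chain_sub_respStepBm_eq_zero_of_fluxFree`**.
[folklore]; 0 cited facts, 0 `def`, 0 `def … : Prop`, 0 sorry.  Asserts NO size; NOTHING of (Q-R)∕(LT)∕(Q-L)∕(C)∕(S)∕«T2Shape»∕«T2Drift»∕(hW, hWall) discharged; NEVER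
«G-an2-4 closed» as (CONV-C); NOT D1, NOT `BetaPertH`, NOT continuum, NOT Clay.  2026-08-22; no existing file touched.
-/

noncomputable section

open Finset
open scoped BigOperators
open Literature.MathematicalPhysics.QuantumFieldTheory
open Literature.MathematicalPhysics.QuantumFieldTheory.Balaban1983to89
open Literature.MathematicalPhysics.QuantumFieldTheory.Balaban1983to89.Beta
open ExpKernelCalculus (MKer Site)
open OneStepResolventKernel (Fib LocStencil)
open KernelWard (divV)
open AffineAveraging (Form1 box toSite dz)
open AveragingContours (blk grad_eq_dz)
open KKTFluctuationKernel (delta1)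
open BalabanCompositeJets (respStep)
open Summit.QuantumFields.BalabanUV.Beta.AxialProjectorBlockMean (bmGaugeAt axProjBmAt)
open Summit.QuantumFields.BalabanUV.Beta.GAN24.Push4 (vertexW)
open Summit.QuantumFields.BalabanUV.Beta.GAN24.Push4Iter (LegFam legChain)
open Summit.QuantumFields.BalabanUV.Beta.GAN24.Push3 (push₃ push₃_def)
open Summit.QuantumFields.BalabanUV.Beta.GAN24.RespStepBm (bmW respStepBm respStepBm_def)
open Summit.QuantumFields.BalabanUV.Beta.GAN24.RespStepBmDecompLegs (legAct)
open Summit.QuantumFields.BalabanUV.Beta.GAN24.RespStepBmDecompExact (respStepBmSeq)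
open Summit.QuantumFields.BalabanUV.Beta.GAN24.RespStepBmDecompPsi (Psi Psi_apply)
open Summit.QuantumFields.BalabanUV.Beta.GAN24.ContactKernelCells (legChain_respStepBmSeq_apply_eq_add_dz legAct_delta1_eq)
open Summit.QuantumFields.BalabanUV.Beta.GAN24.RespStepBmGaugeStep (exists_abs_respStep_le)
open Summit.QuantumFields.BalabanUV.Beta.GAN24.CoDressedColumnPairing (abs_bmGaugeAt_le)
open Summit.QuantumFields.BalabanUV.Beta.GAN24.GaugeTableSlotByParts (vertexW_dz_eq_tsum_mul_divV)
open Summit.QuantumFields.BalabanUV.Beta.GAN24.AxProjBmWindow (axProjBmAt_eq_coProjBmW)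
open Summit.QuantumFields.BalabanUV.Beta.GAN24.ChainTableLegCoClosed (exists_abs_chainGauge_le Psi_eq_blk tsum_blockConst_mul_divV_eq_zero_of_fluxFree)

namespace Summit.QuantumFields.BalabanUV.Beta.GAN24.ChainTableLegTelescopeCell

variable {d : ℕ} {Lc : ℕ} [NeZero Lc]

/-! ## §1 The telescope socket's table cell vanishes on co-closed ∕ flux-free letters -/

section Telescope

variable {rr : Fin (d + 1) → ℕ} (hrr : rr ∈ box (d + 1) Lc) (m k : ℕ)
  {S : Fin (d + 1) → Site (d + 1) → MKer (d + 1) (Fib d)} (hSs : ∀ κ x z a b, Summable fun u => S κ u x z a b)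

omit [NeZero Lc] in
/-- [folklore] `ffRead 0 = 0`. -/
theorem ffRead_zero : Push4.ffRead (0 : MKer (d + 1) (Fib d)) = 0 := by
  have h := Push3.ffRead_sub (0 : MKer (d + 1) (Fib d)) 0
  rwa [sub_self, sub_self] at h

include hrr hSs in
/-- NOT IN PRINT; OUR BOOKKEEPING.  **THE TABLE ONE-GAUGE CELL OF THE TELESCOPE VANISHES ON A CO-CLOSED LETTER**: for ANY kernel legs `l, r` (no hypothesis on them), every depth
`k` and every slot-summable `S` with `divV S ≡ 0`, `push₃ l r (legChain (respStepBmSeq ρ Lc) m k − respStep (Lc^m) (Lc^(m+k+1))) S κ′ u′ = 0` — the difference leg IS the pure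
gauge `dz λ` (`legChain_respStepBmSeq_sub_respStep`), whose table vertex is `Σ'_u λ(u)·divV S u = 0`; so `push₃ = ffRead (Lk l ∘ 0 ∘ Rk r) = 0`. -/
theorem push₃_chainGauge_eq_zero_of_divFree (hdiv : ∀ u, divV S u = 0) (l r : LegFam d) (κ' : Fin (d + 1)) (u' : Site (d + 1)) :
    push₃ l r (legChain (respStepBmSeq (d := d) (toSite rr) Lc) m k - respStep (d := d) (Lc ^ m) (Lc ^ (m + k + 1))) S κ' u' = 0 := by
  obtain ⟨Λ, hΛ⟩ := exists_abs_chainGauge_le (d := d) hrr m k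
  rw [ContactKernelCells.legChain_respStepBmSeq_sub_respStep hrr m k, push₃_def]
  have hV : vertexW (fun μ z κ u => dz (Psi (toSite rr) Lc m k (delta1 μ z)
        - bmGaugeAt (toSite rr) (respStep (d := d) (Lc ^ m) (Lc ^ (m + k + 1)) μ z) Lc) κ u) S κ' u' = 0 := by
    funext x z a b
    have hlam : ∀ (ν : Fin (d + 1)) (U u : Site (d + 1)), |(Psi (toSite rr) Lc m k (delta1 ν U)
        - bmGaugeAt (toSite rr) (respStep (d := d) (Lc ^ m) (Lc ^ (m + k + 1)) ν U) Lc) u| ≤ Λ := fun ν U u => by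
      rw [Pi.sub_apply]; exact hΛ ν U u
    rw [vertexW_dz_eq_tsum_mul_divV (S := S)
      (lam := fun μ y => Psi (toSite rr) Lc m k (delta1 μ y) - bmGaugeAt (toSite rr) (respStep (d := d) (Lc ^ m) (Lc ^ (m + k + 1)) μ y) Lc)
      hlam (hSs · x z a b) κ' u']
    have h0 : ∀ u, divV S u x z a b = 0 := fun u => by rw [hdiv u]; rfl
    simp only [h0, mul_zero, tsum_zero]
    rfl
  rw [hV, StepDriftWitness.comp_zero_right, KernelWardRelative.comp_zero_left, ffRead_zero]

include hrr hSs in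
/-- NOT IN PRINT; OUR BOOKKEEPING.  **THE `h₃` OF `LayerTransportCells.biLoc_smul_push₃_of_telescope` WITH `K₃ = 0`**: on a co-closed letter the weighted table one-gauge cell is
bi-localised with constant `0·W` at any centre and rate (it is the zero kernel). -/
theorem biLoc_smul_push₃_chainGauge_of_divFree (hdiv : ∀ u, divV S u = 0) (l r : LegFam d) (c : ℝ) (κ' : Fin (d + 1)) (u' : Site (d + 1))
    (p q : Site (d + 1)) (W δ' : ℝ) :
    ExpKernelCalculus.BiLoc (c • push₃ l r (legChain (respStepBmSeq (d := d) (toSite rr) Lc) m k - respStep (d := d) (Lc ^ m) (Lc ^ (m + k + 1))) S κ' u') p q (0 * W) δ' := by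
  rw [push₃_chainGauge_eq_zero_of_divFree hrr m k hSs hdiv l r κ' u', smul_zero, zero_mul]
  exact HessKerRate.biLoc_zero p q δ'

include hrr hSs in
/-- NOT IN PRINT; OUR BOOKKEEPING.  **THE FLUX-FREE ANALOGUE**: relative to the one-shot dressed composite column, the remaining table gauge cell vanishes on a flux-free letter —
`push₃ l r (legChain (respStepBmSeq ρ Lc) m k − respStepBm ρ Lc (Lc^m) (Lc^(m+k+1))) S κ′ u′ = 0` (the difference leg is `dz Ψ`, block-constant gauge, zero block fluxes). -/
theorem push₃_chain_sub_respStepBm_eq_zero_of_fluxFree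
    (hflux : ∀ Y : Site (d + 1), ∑ v ∈ box (d + 1) Lc, divV S ((Lc : ℤ) • Y + toSite v) = 0) (l r : LegFam d) (κ' : Fin (d + 1)) (u' : Site (d + 1)) :
    push₃ l r (legChain (respStepBmSeq (d := d) (toSite rr) Lc) m k - respStepBm (d := d) (toSite rr) Lc (Lc ^ m) (Lc ^ (m + k + 1))) S κ' u' = 0 := by
  have hLc : 1 ≤ Lc := Nat.one_le_iff_ne_zero.2 (NeZero.ne Lc)
  obtain ⟨Λ, hΛ⟩ := exists_abs_chainGauge_le (d := d) hrr m k
  obtain ⟨C, hC⟩ := exists_abs_respStep_le (N' := Lc ^ (m + k + 1)) (d := d) (Lc ^ m)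
  -- the difference leg as a function: `dz` of the block-constant gauge `Ψ(δ)` (the outermost `bmGaugeAt` cancels against the window)
  have hleg : legChain (respStepBmSeq (d := d) (toSite rr) Lc) m k - respStepBm (d := d) (toSite rr) Lc (Lc ^ m) (Lc ^ (m + k + 1))
      = fun μ z κ u => dz (Psi (toSite rr) Lc m k (delta1 μ z)) κ u := by
    funext μ z κ u
    rw [Pi.sub_apply, Pi.sub_apply, Pi.sub_apply, Pi.sub_apply, legChain_respStepBmSeq_apply_eq_add_dz hrr m k μ z κ u, respStepBm_def]
    show _ - bmW (toSite rr) Lc (respStep (d := d) (Lc ^ m) (Lc ^ (m + k + 1))) μ z κ u = _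
    rw [bmW, ← axProjBmAt_eq_coProjBmW hLc hrr, axProjBmAt, ← grad_eq_dz]
    simp only [Pi.sub_apply, dz, AveragingContours.grad]
    ring
  -- its gauge function is bounded and block-constant
  have hCi : ∀ M : ℕ, ∃ C : ℝ, ∀ (μ : Fin (d + 1)) (z : Site (d + 1)) (l'' : Fin (d + 1)) (w' : Site (d + 1)),
      |respStep (d := d) M (Lc ^ (m + k + 1)) μ z l'' w'| ≤ C := fun M => exists_abs_respStep_le (N' := Lc ^ (m + k + 1)) M
  choose Ci hCi using hCi
  have hΨb : ∀ (ν : Fin (d + 1)) (U u : Site (d + 1)), |Psi (toSite rr) Lc m k (delta1 ν U) u|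
      ≤ ∑ i ∈ Finset.range k, |((Lc : ℝ) ^ ((d + 1) * (i + 1)))⁻¹| * (2 * ((((d + 1 : ℕ) : ℝ)) * Lc * Ci (Lc ^ (m + i + 1)))) := by
    intro ν U u
    rw [Psi_apply, abs_neg]
    refine (Finset.abs_sum_le_sum_abs _ _).trans (Finset.sum_le_sum fun i _ => ?_)
    rw [abs_mul]
    refine mul_le_mul_of_nonneg_left ?_ (abs_nonneg _)
    rw [legAct_delta1_eq]
    exact abs_bmGaugeAt_le hLc hrr (fun κ w => hCi (Lc ^ (m + i + 1)) ν U κ w) _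
  rw [hleg, push₃_def]
  have hV : vertexW (fun μ z κ u => dz (Psi (toSite rr) Lc m k (delta1 μ z)) κ u) S κ' u' = 0 := by
    funext x z a b
    rw [vertexW_dz_eq_tsum_mul_divV (S := S) (lam := fun μ y => Psi (toSite rr) Lc m k (delta1 μ y)) hΨb (hSs · x z a b) κ' u']
    set G : Site (d + 1) → ℝ := fun B => -∑ i ∈ Finset.range k, ((Lc : ℝ) ^ ((d + 1) * (i + 1)))⁻¹ *
        bmGaugeAt (toSite rr) (legAct (respStep (d := d) (Lc ^ (m + i + 1)) (Lc ^ (m + k + 1))) (delta1 κ' u')) Lc (blk (Lc ^ i) B) with hG_def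
    have hGb : ∀ B, |G B| ≤ ∑ i ∈ Finset.range k, |((Lc : ℝ) ^ ((d + 1) * (i + 1)))⁻¹| * (2 * ((((d + 1 : ℕ) : ℝ)) * Lc * Ci (Lc ^ (m + i + 1)))) := by
      intro B
      rw [hG_def]; simp only [abs_neg]
      refine (Finset.abs_sum_le_sum_abs _ _).trans (Finset.sum_le_sum fun i _ => ?_)
      rw [abs_mul]
      refine mul_le_mul_of_nonneg_left ?_ (abs_nonneg _)
      rw [legAct_delta1_eq]
      exact abs_bmGaugeAt_le hLc hrr (fun κ w => hCi (Lc ^ (m + i + 1)) κ' u' κ w) _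
    have hΨ : ∀ u, Psi (toSite rr) Lc m k (delta1 κ' u') u = G (blk Lc u) := fun u => by rw [Psi_eq_blk]
    simp only [hΨ]
    rw [tsum_blockConst_mul_divV_eq_zero_of_fluxFree hLc hGb (hSs · x z a b) hflux]
    rfl
  rw [hV, StepDriftWitness.comp_zero_right, KernelWardRelative.comp_zero_left, ffRead_zero]

end Telescope

end Summit.QuantumFields.BalabanUV.Beta.GAN24.ChainTableLegTelescopeCell

end
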